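import Literature.MathematicalPhysics.QuantumFieldTheory.Balaban1983to89.B13LocalKernelWalks
import Literature.MathematicalPhysics.QuantumFieldTheory.Balaban1983to89.B13Sqrt27Accretive

/-!
# `Balaban1983to89.B13JointWalkExpansionAlgebra` — T. Bałaban, *Renormalization group approach to lattice gauge field
theories. II. Cluster expansions*, Commun. Math. Phys. **116** (1988) 1–22 [Balaban1988RG2Cluster], p. 13 with [13] =
[Balaban1985BackgroundPropagators] CMP **99** (1985) Thm 3.12 p. 422∕423: «WE REPLACE EACH OPERATOR BY ITS RANDOM WALK
EXPANSION» — the CLOSURE of the tree's joint-walk-expansion shape `B13JointWalkExpansion.JointWalkExpansion` under the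
operator algebra (re-indexing, transposition, scalars, SUMS, PRODUCTS), kernel-checked on the unit torus

statement-level skeleton of published theorems with citation tags; proofs where landed; nothing here is a claim about
the Yang–Mills mass gap

CITATION HEADER (held scan `paper:balaban1988-cmp116-rg-ii-cluster`, text layer p0013 ll. 14–23, read this session;
[B9] quotations as render-checked in `B9SectDWalk`'s header).  [II] p. 13: *"Other localization domains X are chosen as
in Sect. C [13], i.e. they are unions of small, connected families of M₁-cubes, and we assume that dist(X, Z₀) > ⅔M. For
this class of localization domains we construct the generalized random walk expansions. This construction was discussed
in [13] for all operators determining Δ_k, and for C^{(k)}(Z₀), but not for (C^{(k)})^{1/2}."*; p. 3: *"A propagator is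
represented by the sum (3.107) [13] … The term corresponding to a walk ω in (1.6) can be bounded, as (3.108) [13], by
(1.7)"*; (1.11) p. 5 (*"m is the number of the parameters s connected with the walk ω"*); p. 15 (*"The quadratic forms
and covariances in H(Z) are analytic functions on the space of configurations (U, J)"*, Γ_k(Z₀,σ(Z)) =
C*Δ_k(σ(Z))C_{Z₀ᶜ}(C^{(k)})^{1/2}(σ(Z)) after (2.14)).  [B9] p. 422: *"Of course Theorem 3.10 holds also because we
replace each operator in (3.130) by its random walk expansion"*; Thm 3.12 p. 423; (3.92)–(3.94) p. 410 (*"We use part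
of the exponentials to control the sum over yᵢ's … the remaining are used to construct an overall exponential
factor"*, the walk distance (3.93)); (3.107)–(3.108) p. 416.  [B6] = [Balaban1984PropagatorsII] (2.54) p. 233, Lemma
2.1 (2.61) p. 234.

WHY (cell `pub-ymgap`, node N10; FAN-OUT v1.1 §N10 s1).  NODE O's rung `NodeOLettersOfWalksAcross.UniformWalksAcross 𝓣 q`
asks, per (2.14)-term, for `JointWalkExpansion`s of the local factor `L = C*Δ_k(σ)C_{Z₀ᶜ}`, the full precision
`P = C*_{Z₀ᶜ}Δ_k(σ)C_{Z₀ᶜ}` and the term precision `A2 = Δ^{(k)}(Z₀,σ)` (`TermWalks.product ∕ .precision`).  These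
operators are SUMS and PRODUCTS of walk-expanded primitives (the propagators of [13] Thm 3.10) with local operators
((2.5)–(2.9) p. 12–14).  The tree had the shape (`B13JointWalkExpansion`), the one-step base case
(`B13LocalKernelWalks.jointWalkExpansion_local`) and the [B9] walk algebra over abstract block norms (`B9SectDWalk`:
`infConv`, `conv_walk_le`, `MajSumLe.prod`, `through_infConv_left∕right`), but the closure of the shape itself only
Summit-side (cell `pub-balaban-gaps`: `Gaps.D4WalkSum.jointWalkExpansion_add` — the sum; `Spine/NE5/ProductWalks.walkMajorants_mul`
+ `Gaps.D4WalkProduct.jointWalkExpansion_mul` — the product; Literature cannot import Summits, and NODE O's chain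
`NodeOLetters*` ∕ `B13TermWalkData*` is Literature).  This module is the LITERATURE HOME of that closure at the FULL shape
(all eight fields, including termwise analyticity and the σ-structure `indep ∕ through`; §3–§4 are twins BY STATEMENT of
the Summit-side files just named, re-proved here over `B9SectDWalk`, not imported), plus (§5, no twin) ACCRETIVITY at
complex `(σ,u)` from the same walk data, so that the three N10 kernels' expansions AND their accretivity constants are
compositions BY NAME of the primitives' expansions and the positivity at `(U,0)`.

WHAT THIS FILE PROVES (all `theorem`s; geometry `toB6 (torusGeom Nf 0 0 0) 0 True` = the one-scale ℓ¹ site torus,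
`d₁ = tdist1 Nf`).
§1 Tools: `summable_majorant_of_majSumLe` (bounded partial sums ⇒ summable), `exp_infConv_le_sum`, (private)
   `sum_loc_le_mul_sum` (fibre multiplicity of a locator), `norm_mul_entry_le_of_walks(_mirror)` (the (3.92)→(3.94) entry bound of a product
   of two walk terms: the junction row sum (2.61) is paid from the excess rate of ONE factor, the other rate rides on
   the concatenated distance `D₁ □ D₂`), `majSumLe_mul` (summability of the product family WITHOUT counting walks).
§2 One-factor operations: `jointWalkExpansion_submatrix` (re-indexing along locator-compatible maps — restrictions
   such as `·_{Z₀ᶜ}`, block embeddings), `jointWalkExpansion_transpose` (walk distances flipped; `C*` of a real u-independent `C` is its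
   transpose), `jointWalkExpansion_smul` (constant scalar), `jointWalkExpansion_neg`.
§3 SUM: `jointWalkExpansion_add` (terms on `W₁ ⊕ W₂`), `jointWalkExpansion_add_same`, `domBy_add`.
§4 PRODUCT: `jointWalkExpansion_mul` (terms `T₁ω₁·T₂ω₂` on `W₁ × W₂`, σ-carrying sub-family `ω₁ ∈ SX₁ ∨ ω₂ ∈ SX₂`,
   amplitudes `(mc)A₁A₂`, distance `D₁ □ D₂`, rates `ρ + σ ≤ ρ₁`, `ρ ≤ ρ₂`, `ρᵢ − εᵢ ≤ ρ − ε`, `κ ≤ κ₂`, `κ + σ′ ≤ κ₁`,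
   constant `(mc)K̄₁K̄₂c′`; BOTH factors' distances dominate `d₁` — true for every (3.93) distance), `jointWalkExpansion_mul_mirror`
   (the RIGHT factor pays), `domBy_mul`, `jointWalkExpansion_mul_torus` (row sums discharged on every torus, `rowSum_torus`).
§5 ACCRETIVITY by the perturbative argument of p. 15: `sub_ref_entry_le_of_jointWalkExpansion` (the full (2.16)-shape
   difference `2K̄(e^{−εR_σ} + α/R)e^{−κd₁}` to the reference value, σ-part + u-part from ONE expansion),
   `accretive_of_jointWalkExpansion` (reference value real `γ`-coercive ⟹ `P(σ,u)` is
   `(γ − 2K̄(e^{−εR_σ} + α/R)c_V)`-accretive on polydisc × `α`-ball — the two accretivity fields of `TermWalks`).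
§6 Non-vacuity, torus-uniformly: `jointWalkExpansion_mul_local` — the product hypotheses (`DomBy`, fibre multiplicity,
   row sums, rate windows) are jointly met by any two one-step local families, with `Nf`-free constants.
HONEST FRAMING: kernel-level bookkeeping (finite matrices, finite tori, absolutely convergent series) over the tree's
hypothesis SHAPE; NOTHING of Bałaban's `G_k(Ω)`, `Δ_k`, `C^{(k)}(Z₀)` is constructed or asserted — whether HIS primitives
carry such expansions k-uniformly at complex backgrounds ([13] Thm 3.10; cell GAPS G-B9-10; node N06) stays the INPUT;
NOT a discharge of N10; no new named fact; no `sorry`; no instance, no notation; NOT [B12] Thm 2, NOT continuum ∕ ℝ⁴ ∕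
mass gap ∕ Clay.
-/

noncomputable section

namespace Literature.MathematicalPhysics.QuantumFieldTheory.Balaban1983to89.B13JointWalkExpansionAlgebra

open Metric Set Finset
open scoped Matrix
open Literature.MathematicalPhysics.QuantumFieldTheory.Balaban1983to89
open Literature.MathematicalPhysics.QuantumFieldTheory.Balaban1983to89.B9SectDWalk
  (Through MajSumLe DomBy infConv conv conv_walk_le conv_walk_le_mirror conv_exp_shape_le exists_infConv_eq le_infConv
    domBy_infConv through_infConv_left through_infConv_right)
open Literature.MathematicalPhysics.QuantumFieldTheory.Balaban1983to89.B9SectDSup (DistSymm)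
open Literature.MathematicalPhysics.QuantumFieldTheory.Balaban1983to89.B9Thm34Ext (toB6)
open Literature.MathematicalPhysics.QuantumFieldTheory.Balaban1983to89.B9Thm37GlueTorus
  (torusGeom tdist1 tdist1_nonneg tdist1_comm tdist1_triangle hdnn_torusGeom htri_torusGeom)
open Literature.MathematicalPhysics.QuantumFieldTheory.Balaban1983to89.TreeLengthTorus (TPt)
open Literature.MathematicalPhysics.QuantumFieldTheory.Balaban1983to89.B5TorusCover (UT)
open Literature.MathematicalPhysics.QuantumFieldTheory.Balaban1983to89.B11SectG (RowSum)
open Literature.MathematicalPhysics.QuantumFieldTheory.Balaban1983to89.B13JointWalkExpansion (JointWalkExpansion)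
open Literature.MathematicalPhysics.QuantumFieldTheory.Balaban1983to89.B13LocalKernelWalks (rowSum_torus)
open Literature.MathematicalPhysics.QuantumFieldTheory.Balaban1983to89.B13Eq216AnalyticStep (entry_sub_le_of_differentiableOn)
open Literature.MathematicalPhysics.QuantumFieldTheory.Balaban1983to89.B13Sqrt27Accretive (accretive_of_coercive_add)

variable {ν : ℕ} {Nf : Fin ν → ℕ} [∀ i, NeZero (Nf i)]

/-! ## §1. Tools: summability from bounded partial sums; the (3.92)→(3.94) entry bound of a product of walk terms -/

section Tools

omit [∀ i, NeZero (Nf i)] in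
/-- **Bounded partial sums ⇒ summable** for a non-negative majorant family read at one pair of sites (the entrywise
form of [B9] p. 416 *"From (3.108) it follows that the expansion (3.107) is convergent"*). [cite: Balaban1985BackgroundPropagators, p.416 (after (3.108))] -/
theorem summable_majorant_of_majSumLe {g : B6.Geometry} {W : Type} {A : W → ℝ} {D : W → g.Site → g.Site → ℝ}
    {r ρ : ℝ} {Kbar : g.Site → g.Site → ℝ} (hA : ∀ ω, 0 ≤ A ω) (hD : ∀ ω a b, 0 ≤ D ω a b) (hr : r ≤ ρ)
    (hsum : MajSumLe (fun ω a b => A ω * Real.exp (-(r * D ω a b))) Kbar) (a b : g.Site) :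
    Summable fun ω => A ω * Real.exp (-(ρ * D ω a b)) := by
  refine summable_of_sum_le (fun ω => mul_nonneg (hA ω) (Real.exp_nonneg _)) fun S =>
    (Finset.sum_le_sum fun ω _ => ?_).trans (hsum S a b)
  exact mul_le_mul_of_nonneg_left (Real.exp_le_exp.2 (neg_le_neg (mul_le_mul_of_nonneg_right hr (hD ω a b)))) (hA ω)

omit [∀ i, NeZero (Nf i)] in
/-- **Fibre multiplicity**: a non-negative function of the locator, summed over an index type whose locator has fibres of
size `≤ m`, is at most `m` times its sum over the sites. [folklore] -/
private theorem sum_loc_le_mul_sum {n : Type} [Fintype n] (locn : n → UT Nf) {m : ℕ}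
    (hfib : ∀ y : UT Nf, (Finset.univ.filter fun k => locn k = y).card ≤ m) (f : UT Nf → ℝ) (hf : ∀ y, 0 ≤ f y) :
    ∑ k, f (locn k) ≤ m * ∑ y : UT Nf, f y := by
  classical
  rw [← Finset.sum_fiberwise_of_maps_to (g := locn) (t := Finset.univ) (fun k _ => Finset.mem_univ _)]
  rw [Finset.mul_sum]
  refine Finset.sum_le_sum fun y _ => ?_
  rw [Finset.sum_congr rfl fun k hk => by rw [(Finset.mem_filter.1 hk).2], Finset.sum_const, nsmul_eq_mul]
  exact mul_le_mul_of_nonneg_right (by exact_mod_cast hfib y) (hf y)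

/-- **PER-TERM BOUND OF A PRODUCT OF TWO WALK TERMS** ((3.92)→(3.94) at the entry level; Literature home of the
Summit-side `Spine/NE5/ProductWalks.norm_mul_entry_le_of_walks`).  Left factor entries `≤ A₁e^{−ρ₁D₁(loc i, loc k)}`
with `D₁ ≥ d₁`, right factor entries `≤ A₂e^{−ρ₂D₂(loc k, loc j)}`, `D₂ ≥ 0`, middle locator of fibre multiplicity
`≤ m`, row sum (2.61) at rate `σ ≥ 0` with constant `c`, `ρ + σ ≤ ρ₁`, `0 ≤ ρ ≤ ρ₂`: the product entry is
`≤ (m·c·A₁A₂)·e^{−ρ(D₁ □ D₂)(loc i, loc j)}` — *"part of the exponentials"* (the LEFT factor's excess `σ`) controls the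
junction sum, the rate `ρ` rides undiminished on the concatenated distance (3.93).
[cite: Balaban1985BackgroundPropagators, (3.92)–(3.94) p.410; Balaban1984PropagatorsII, (2.61) p.234] -/
theorem norm_mul_entry_le_of_walks {p n q : Type} [Fintype n] (locp : p → UT Nf) (locn : n → UT Nf)
    (locq : q → UT Nf) {m : ℕ} (hfib : ∀ y : UT Nf, (Finset.univ.filter fun k => locn k = y).card ≤ m)
    {M₁ : Matrix p n ℂ} {M₂ : Matrix n q ℂ} {A₁ A₂ ρ₁ ρ₂ ρ σ c : ℝ} {D₁ D₂ : UT Nf → UT Nf → ℝ}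
    (hA₁ : 0 ≤ A₁) (hA₂ : 0 ≤ A₂) (hρ : 0 ≤ ρ) (hρ₂ : ρ ≤ ρ₂) (hσ : 0 ≤ σ) (hρ₁ : ρ + σ ≤ ρ₁)
    (hD₁ : DomBy (toB6 (torusGeom Nf 0 0 0) 0 True) D₁) (hD₂ : ∀ a b, 0 ≤ D₂ a b)
    (hrow : RowSum (toB6 (torusGeom Nf 0 0 0) 0 True) σ c)
    (h₁ : ∀ i k, ‖M₁ i k‖ ≤ A₁ * Real.exp (-(ρ₁ * D₁ (locp i) (locn k))))
    (h₂ : ∀ k j, ‖M₂ k j‖ ≤ A₂ * Real.exp (-(ρ₂ * D₂ (locn k) (locq j)))) (i : p) (j : q) :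
    ‖(M₁ * M₂) i j‖ ≤ (m * c * (A₁ * A₂)) *
      Real.exp (-(ρ * infConv (g := toB6 (torusGeom Nf 0 0 0) 0 True) D₁ D₂ (locp i) (locq j))) := by
  have hF : ∀ y : UT Nf, 0 ≤ Real.exp (-(ρ₁ * D₁ (locp i) y)) * Real.exp (-(ρ * D₂ y (locq j))) :=
    fun y => mul_nonneg (Real.exp_nonneg _) (Real.exp_nonneg _)
  calc ‖(M₁ * M₂) i j‖ = ‖∑ k, M₁ i k * M₂ k j‖ := by rw [Matrix.mul_apply]
    _ ≤ ∑ k, ‖M₁ i k‖ * ‖M₂ k j‖ :=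
        (norm_sum_le _ _).trans (le_of_eq (Finset.sum_congr rfl fun k _ => norm_mul _ _))
    _ ≤ ∑ k, (A₁ * Real.exp (-(ρ₁ * D₁ (locp i) (locn k)))) * (A₂ * Real.exp (-(ρ * D₂ (locn k) (locq j)))) := by
        refine Finset.sum_le_sum fun k _ => mul_le_mul (h₁ i k) ((h₂ k j).trans ?_) (norm_nonneg _)
          (mul_nonneg hA₁ (Real.exp_nonneg _))
        exact mul_le_mul_of_nonneg_left (Real.exp_le_exp.2 (by nlinarith [hD₂ (locn k) (locq j)])) hA₂
    _ = (A₁ * A₂) * ∑ k, Real.exp (-(ρ₁ * D₁ (locp i) (locn k))) * Real.exp (-(ρ * D₂ (locn k) (locq j))) := by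
        rw [Finset.mul_sum]; exact Finset.sum_congr rfl fun k _ => by ring
    _ ≤ (A₁ * A₂) * (m * ∑ y : UT Nf, Real.exp (-(ρ₁ * D₁ (locp i) y)) * Real.exp (-(ρ * D₂ y (locq j)))) :=
        mul_le_mul_of_nonneg_left (sum_loc_le_mul_sum locn hfib _ hF) (mul_nonneg hA₁ hA₂)
    _ ≤ (A₁ * A₂) * (m * (c *
          Real.exp (-(ρ * infConv (g := toB6 (torusGeom Nf 0 0 0) 0 True) D₁ D₂ (locp i) (locq j))))) := by
        gcongr
        exact conv_walk_le (g := toB6 (torusGeom Nf 0 0 0) 0 True) (hdnn_torusGeom 0 0 0) hrow hσ hρ hρ₁ hD₁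
          (locp i) (locq j)
    _ = (m * c * (A₁ * A₂)) *
          Real.exp (-(ρ * infConv (g := toB6 (torusGeom Nf 0 0 0) 0 True) D₁ D₂ (locp i) (locq j))) := by ring

omit [∀ i, NeZero (Nf i)] in
/-- `d₁` is symmetric on the one-scale torus geometry (`tdist1_comm`). [folklore] -/
private theorem distSymm_torus [∀ i, NeZero (Nf i)] : DistSymm (toB6 (torusGeom Nf 0 0 0) 0 True) :=
  fun y y' => tdist1_comm y y'

/-- **Per-term product bound, MIRROR form**: the RIGHT factor (`D₂ ≥ d₁`, `ρ + σ ≤ ρ₂`) pays the junction sum (symmetry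
of `d₁`), the left factor only needs `ρ ≤ ρ₁`. [cite: Balaban1985BackgroundPropagators, (3.92)–(3.94) p.410; Balaban1984PropagatorsII, (2.61) p.234] -/
theorem norm_mul_entry_le_of_walks_mirror {p n q : Type} [Fintype n] (locp : p → UT Nf) (locn : n → UT Nf)
    (locq : q → UT Nf) {m : ℕ} (hfib : ∀ y : UT Nf, (Finset.univ.filter fun k => locn k = y).card ≤ m)
    {M₁ : Matrix p n ℂ} {M₂ : Matrix n q ℂ} {A₁ A₂ ρ₁ ρ₂ ρ σ c : ℝ} {D₁ D₂ : UT Nf → UT Nf → ℝ}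
    (hA₁ : 0 ≤ A₁) (hA₂ : 0 ≤ A₂) (hρ : 0 ≤ ρ) (hρ₁ : ρ ≤ ρ₁) (hσ : 0 ≤ σ) (hρ₂ : ρ + σ ≤ ρ₂)
    (hD₁ : ∀ a b, 0 ≤ D₁ a b) (hD₂ : DomBy (toB6 (torusGeom Nf 0 0 0) 0 True) D₂)
    (hrow : RowSum (toB6 (torusGeom Nf 0 0 0) 0 True) σ c)
    (h₁ : ∀ i k, ‖M₁ i k‖ ≤ A₁ * Real.exp (-(ρ₁ * D₁ (locp i) (locn k))))
    (h₂ : ∀ k j, ‖M₂ k j‖ ≤ A₂ * Real.exp (-(ρ₂ * D₂ (locn k) (locq j)))) (i : p) (j : q) :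
    ‖(M₁ * M₂) i j‖ ≤ (m * c * (A₁ * A₂)) *
      Real.exp (-(ρ * infConv (g := toB6 (torusGeom Nf 0 0 0) 0 True) D₁ D₂ (locp i) (locq j))) := by
  have hF : ∀ y : UT Nf, 0 ≤ Real.exp (-(ρ * D₁ (locp i) y)) * Real.exp (-(ρ₂ * D₂ y (locq j))) :=
    fun y => mul_nonneg (Real.exp_nonneg _) (Real.exp_nonneg _)
  calc ‖(M₁ * M₂) i j‖ = ‖∑ k, M₁ i k * M₂ k j‖ := by rw [Matrix.mul_apply]
    _ ≤ ∑ k, ‖M₁ i k‖ * ‖M₂ k j‖ :=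
        (norm_sum_le _ _).trans (le_of_eq (Finset.sum_congr rfl fun k _ => norm_mul _ _))
    _ ≤ ∑ k, (A₁ * Real.exp (-(ρ * D₁ (locp i) (locn k)))) * (A₂ * Real.exp (-(ρ₂ * D₂ (locn k) (locq j)))) := by
        refine Finset.sum_le_sum fun k _ => mul_le_mul ((h₁ i k).trans ?_) (h₂ k j) (norm_nonneg _)
          (mul_nonneg hA₁ (Real.exp_nonneg _))
        exact mul_le_mul_of_nonneg_left (Real.exp_le_exp.2 (by nlinarith [hD₁ (locp i) (locn k)])) hA₁
    _ = (A₁ * A₂) * ∑ k, Real.exp (-(ρ * D₁ (locp i) (locn k))) * Real.exp (-(ρ₂ * D₂ (locn k) (locq j))) := by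
        rw [Finset.mul_sum]; exact Finset.sum_congr rfl fun k _ => by ring
    _ ≤ (A₁ * A₂) * (m * ∑ y : UT Nf, Real.exp (-(ρ * D₁ (locp i) y)) * Real.exp (-(ρ₂ * D₂ y (locq j)))) :=
        mul_le_mul_of_nonneg_left (sum_loc_le_mul_sum locn hfib _ hF) (mul_nonneg hA₁ hA₂)
    _ ≤ (A₁ * A₂) * (m * (c *
          Real.exp (-(ρ * infConv (g := toB6 (torusGeom Nf 0 0 0) 0 True) D₁ D₂ (locp i) (locq j))))) := by
        gcongr
        exact conv_walk_le_mirror (g := toB6 (torusGeom Nf 0 0 0) 0 True) distSymm_torus (hdnn_torusGeom 0 0 0)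
          hrow hσ hρ hρ₂ hD₂ (locp i) (locq j)
    _ = (m * c * (A₁ * A₂)) *
          Real.exp (-(ρ * infConv (g := toB6 (torusGeom Nf 0 0 0) 0 True) D₁ D₂ (locp i) (locq j))) := by ring

/-- **The exponential of the inf-convolution is below the junction sum**: for `r₁, r₂ ≤ ρ` and `D₁, D₂ ≥ 0`,
`e^{−ρ(D₁ □ D₂)(a,b)} ≤ Σ_y e^{−r₁D₁(a,y)}e^{−r₂D₂(y,b)}` (the infimum (3.93) is attained on the finite torus: one term of a
non-negative sum). [cite: Balaban1985BackgroundPropagators, (3.93) p.410] -/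
theorem exp_infConv_le_sum {D₁ D₂ : UT Nf → UT Nf → ℝ} {ρ r₁ r₂ : ℝ} (h₁ : r₁ ≤ ρ) (h₂ : r₂ ≤ ρ)
    (hD₁ : ∀ a b, 0 ≤ D₁ a b) (hD₂ : ∀ a b, 0 ≤ D₂ a b) (a b : UT Nf) :
    Real.exp (-(ρ * infConv (g := toB6 (torusGeom Nf 0 0 0) 0 True) D₁ D₂ a b)) ≤
      ∑ y : UT Nf, Real.exp (-(r₁ * D₁ a y)) * Real.exp (-(r₂ * D₂ y b)) := by
  obtain ⟨y, hy⟩ := exists_infConv_eq (g := toB6 (torusGeom Nf 0 0 0) 0 True) D₁ D₂ a b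
  have hm₁ := mul_nonneg (sub_nonneg.2 h₁) (hD₁ a y)
  have hm₂ := mul_nonneg (sub_nonneg.2 h₂) (hD₂ y b)
  have hexp : r₁ * D₁ a y + r₂ * D₂ y b ≤ ρ * infConv (g := toB6 (torusGeom Nf 0 0 0) 0 True) D₁ D₂ a b := by
    rw [hy]; nlinarith
  have hone : Real.exp (-(ρ * infConv (g := toB6 (torusGeom Nf 0 0 0) 0 True) D₁ D₂ a b)) ≤
      Real.exp (-(r₁ * D₁ a y)) * Real.exp (-(r₂ * D₂ y b)) := by
    rw [← Real.exp_add]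
    exact Real.exp_le_exp.2 (by linarith)
  exact hone.trans (Finset.single_le_sum (f := fun y => Real.exp (-(r₁ * D₁ a y)) * Real.exp (-(r₂ * D₂ y b)))
    (fun _ _ => mul_nonneg (Real.exp_nonneg _) (Real.exp_nonneg _)) (Finset.mem_univ y))

/-- **SUMMABILITY OF THE PRODUCT FAMILY WITHOUT COUNTING WALKS** ((3.108) summed; `MajSumLe.prod` + the (2.54)∕(2.61)
shape closure `conv_exp_shape_le`).  Factor majorant families at rates `r₁`, `r₂` with partial sums `≤ K̄₁e^{−κ₁d₁}`,
`≤ K̄₂e^{−κ₂d₁}`; then the product majorants `(C·A₁A₂)e^{−ρ(D₁ □ D₂)}` at any rate `ρ ≥ r₁, r₂` have partial sums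
`≤ C·K̄₁K̄₂c′·e^{−κd₁}` for `0 ≤ κ ≤ κ₂`, `κ + σ′ ≤ κ₁` (row sum at rate `σ′`, constant `c′`) — [B9] p. 422: the sum over
concatenated walks is controlled by the product structure. [cite: Balaban1985BackgroundPropagators, p.416 (after (3.108)), p.422; Balaban1984PropagatorsII, (2.54) p.233, (2.61) p.234] -/
theorem majSumLe_mul {W₁ W₂ : Type} {A₁ : W₁ → ℝ} {A₂ : W₂ → ℝ} {D₁ : W₁ → UT Nf → UT Nf → ℝ}
    {D₂ : W₂ → UT Nf → UT Nf → ℝ} {r₁ r₂ ρ κ₁ κ₂ κ σ' c' Kbar₁ Kbar₂ C : ℝ}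
    (hA₁ : ∀ ω, 0 ≤ A₁ ω) (hA₂ : ∀ ω, 0 ≤ A₂ ω) (hD₁ : ∀ ω a b, 0 ≤ D₁ ω a b) (hD₂ : ∀ ω a b, 0 ≤ D₂ ω a b)
    (h₁ : r₁ ≤ ρ) (h₂ : r₂ ≤ ρ) (hC : 0 ≤ C) (hK₁ : 0 ≤ Kbar₁) (hK₂ : 0 ≤ Kbar₂)
    (hκ : 0 ≤ κ) (hκ₂ : κ ≤ κ₂) (hκ₁ : κ + σ' ≤ κ₁) (hrow : RowSum (toB6 (torusGeom Nf 0 0 0) 0 True) σ' c')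
    (hs₁ : MajSumLe (g := toB6 (torusGeom Nf 0 0 0) 0 True) (fun ω a b => A₁ ω * Real.exp (-(r₁ * D₁ ω a b)))
      (fun a b => Kbar₁ * Real.exp (-(κ₁ * tdist1 Nf a b))))
    (hs₂ : MajSumLe (g := toB6 (torusGeom Nf 0 0 0) 0 True) (fun ω a b => A₂ ω * Real.exp (-(r₂ * D₂ ω a b)))
      (fun a b => Kbar₂ * Real.exp (-(κ₂ * tdist1 Nf a b)))) :
    MajSumLe (g := toB6 (torusGeom Nf 0 0 0) 0 True) (fun (ω : W₁ × W₂) a b => (C * (A₁ ω.1 * A₂ ω.2)) *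
        Real.exp (-(ρ * infConv (g := toB6 (torusGeom Nf 0 0 0) 0 True) (D₁ ω.1) (D₂ ω.2) a b)))
      (fun a b => (C * Kbar₁ * Kbar₂ * c') * Real.exp (-(κ * tdist1 Nf a b))) := by
  intro S a b
  have hprod := MajSumLe.prod (g := toB6 (torusGeom Nf 0 0 0) 0 True) (κ := 1) zero_le_one
    (fun ω a b => mul_nonneg (hA₁ ω) (Real.exp_nonneg _)) (fun ω a b => mul_nonneg (hA₂ ω) (Real.exp_nonneg _))
    hs₁ hs₂
  have hterm : ∀ ω : W₁ × W₂, (C * (A₁ ω.1 * A₂ ω.2)) *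
      Real.exp (-(ρ * infConv (g := toB6 (torusGeom Nf 0 0 0) 0 True) (D₁ ω.1) (D₂ ω.2) a b)) ≤
      C * conv (g := toB6 (torusGeom Nf 0 0 0) 0 True) 1 (fun a' b' => A₁ ω.1 * Real.exp (-(r₁ * D₁ ω.1 a' b')))
        (fun a' b' => A₂ ω.2 * Real.exp (-(r₂ * D₂ ω.2 a' b'))) a b := by
    intro ω
    have hle := exp_infConv_le_sum (Nf := Nf) h₁ h₂ (hD₁ ω.1) (hD₂ ω.2) a b
    have : conv (g := toB6 (torusGeom Nf 0 0 0) 0 True) 1 (fun a' b' => A₁ ω.1 * Real.exp (-(r₁ * D₁ ω.1 a' b')))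
        (fun a' b' => A₂ ω.2 * Real.exp (-(r₂ * D₂ ω.2 a' b'))) a b =
        (A₁ ω.1 * A₂ ω.2) * ∑ y : UT Nf, Real.exp (-(r₁ * D₁ ω.1 a y)) * Real.exp (-(r₂ * D₂ ω.2 y b)) := by
      rw [conv, Finset.mul_sum]; exact Finset.sum_congr rfl fun y _ => by ring
    rw [this, mul_assoc]
    exact mul_le_mul_of_nonneg_left (mul_le_mul_of_nonneg_left hle (mul_nonneg (hA₁ _) (hA₂ _))) hC
  calc ∑ ω ∈ S, (C * (A₁ ω.1 * A₂ ω.2)) *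
          Real.exp (-(ρ * infConv (g := toB6 (torusGeom Nf 0 0 0) 0 True) (D₁ ω.1) (D₂ ω.2) a b))
      ≤ ∑ ω ∈ S, C * conv (g := toB6 (torusGeom Nf 0 0 0) 0 True) 1
          (fun a' b' => A₁ ω.1 * Real.exp (-(r₁ * D₁ ω.1 a' b')))
          (fun a' b' => A₂ ω.2 * Real.exp (-(r₂ * D₂ ω.2 a' b'))) a b := Finset.sum_le_sum fun ω _ => hterm ω
    _ = C * ∑ ω ∈ S, conv (g := toB6 (torusGeom Nf 0 0 0) 0 True) 1
          (fun a' b' => A₁ ω.1 * Real.exp (-(r₁ * D₁ ω.1 a' b')))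
          (fun a' b' => A₂ ω.2 * Real.exp (-(r₂ * D₂ ω.2 a' b'))) a b := by rw [Finset.mul_sum]
    _ ≤ C * conv (g := toB6 (torusGeom Nf 0 0 0) 0 True) 1 (fun a' b' => Kbar₁ * Real.exp (-(κ₁ * tdist1 Nf a' b')))
          (fun a' b' => Kbar₂ * Real.exp (-(κ₂ * tdist1 Nf a' b'))) a b := mul_le_mul_of_nonneg_left (hprod S a b) hC
    _ ≤ C * (1 * Kbar₁ * Kbar₂ * c' * Real.exp (-(κ * tdist1 Nf a b))) :=
        mul_le_mul_of_nonneg_left (conv_exp_shape_le (g := toB6 (torusGeom Nf 0 0 0) 0 True)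
          (htri_torusGeom 0 0 0 0 True) (hdnn_torusGeom 0 0 0) hrow zero_le_one hK₁ hK₂ hκ hκ₂ hκ₁ a b) hC
    _ = (C * Kbar₁ * Kbar₂ * c') * Real.exp (-(κ * tdist1 Nf a b)) := by ring

omit [∀ i, NeZero (Nf i)] in
/-- Weakening a per-term bound to a smaller rate (`A, D ≥ 0`). [cite: Balaban1985BackgroundPropagators, (3.108) p.416] -/
theorem maj_mono_rate {A D r r' : ℝ} (hA : 0 ≤ A) (hD : 0 ≤ D) (h : r' ≤ r) :
    A * Real.exp (-(r * D)) ≤ A * Real.exp (-(r' * D)) :=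
  mul_le_mul_of_nonneg_left (Real.exp_le_exp.2 (by nlinarith)) hA

omit [∀ i, NeZero (Nf i)] in
/-- Termwise domination passes `MajSumLe` to the smaller family. [folklore] -/
private theorem majSumLe_of_le {g : B6.Geometry} {W : Type} {K₁ K₂ : W → g.Site → g.Site → ℝ}
    {Kbar : g.Site → g.Site → ℝ} (hle : ∀ ω a b, K₁ ω a b ≤ K₂ ω a b) (h : MajSumLe K₂ Kbar) :
    MajSumLe K₁ Kbar :=
  fun S a b => (Finset.sum_le_sum fun ω _ => hle ω a b).trans (h S a b)

omit [∀ i, NeZero (Nf i)] in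
/-- Splitting a partial sum over `W₁ ⊕ W₂` into its left and right parts. [folklore] -/
private theorem majSumLe_sum {g : B6.Geometry} {W₁ W₂ : Type} {M₁ : W₁ → g.Site → g.Site → ℝ}
    {M₂ : W₂ → g.Site → g.Site → ℝ} {B₁ B₂ : g.Site → g.Site → ℝ} (h₁ : MajSumLe M₁ B₁) (h₂ : MajSumLe M₂ B₂) :
    MajSumLe (fun ω : W₁ ⊕ W₂ => Sum.elim M₁ M₂ ω) (fun a b => B₁ a b + B₂ a b) := by
  intro S a b
  rw [← Finset.toLeft_disjSum_toRight (u := S), Finset.sum_disjSum]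
  exact add_le_add (h₁ S.toLeft a b) (h₂ S.toRight a b)

end Tools

/-! ## §2. One-factor operations: re-indexing, transposition, constant scalars -/

section OneFactor

variable {d N' : ℕ} {p n p' n' : Type}
variable {E : Type*} [NormedAddCommGroup E] [NormedSpace ℂ E]
variable {c : B13.Consts} {locp : p → UT Nf} {locn : n → UT Nf} {K : (TPt d N' → ℂ) → E → Matrix p n ℂ}
variable {X : Finset (UT Nf)} {R ε kap Kbar : ℝ}
variable {W : Type} {T : W → (TPt d N' → ℂ) → E → Matrix p n ℂ} {SX : Set W} {A : W → ℝ}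
variable {D : W → UT Nf → UT Nf → ℝ} {ρ : ℝ}

/-- **RE-INDEXING** (restriction of rows ∕ columns to a sub-block, e.g. `C ↦ C_{Z₀ᶜ}`, or a block embedding): along maps
`f`, `g` COMPATIBLE WITH THE LOCATORS (`locp′ = locp ∘ f`, `locn′ = locn ∘ g`) a joint walk expansion of `K` is one of
`(σ,u) ↦ (K σ u).submatrix f g` with the same terms re-indexed and the same constants — every field is read entrywise.
[cite: Balaban1988RG2Cluster, (2.5) p.12, p.13; Balaban1985BackgroundPropagators, (3.107)–(3.108) p.416] -/
theorem jointWalkExpansion_submatrix (h : JointWalkExpansion c locp locn K X R ε kap Kbar T SX A D ρ)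
    (f : p' → p) (g : n' → n) :
    JointWalkExpansion c (locp ∘ f) (locn ∘ g) (fun σ u => (K σ u).submatrix f g) X R ε kap Kbar
      (fun ω σ u => (T ω σ u).submatrix f g) SX A D ρ where
  hasSum σ hσ u hu i j := by simpa using h.hasSum σ hσ u hu (f i) (g j)
  termAnalytic ω σ hσ i j := by simpa using h.termAnalytic ω σ hσ (f i) (g j)
  maj ω σ hσ u hu i j := by simpa using h.maj ω σ hσ u hu (f i) (g j)
  majSum := h.majSum
  indep ω hω σ hσ := by rw [h.indep ω hω σ hσ]
  through := h.through
  A_nonneg := h.A_nonneg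
  D_nonneg := h.D_nonneg

/-- **TRANSPOSITION** (for `C*` of a REAL, configuration-independent local operator `C`, which is its transpose; the
adjoint of a u-dependent kernel is NOT covered — conjugation is not holomorphic): the transposed family has the
transposed terms, locators swapped, walk distances flipped `D′_ω(a,b) = D_ω(b,a)`; the σ-structure and the reduced-rate
summability survive by the symmetry of `d₁`. [cite: Balaban1988RG2Cluster, (2.5) p.12, p.15; Balaban1985BackgroundPropagators, (3.107)–(3.108) p.416] -/
theorem jointWalkExpansion_transpose (h : JointWalkExpansion c locp locn K X R ε kap Kbar T SX A D ρ) :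
    JointWalkExpansion c locn locp (fun σ u => (K σ u).transpose) X R ε kap Kbar
      (fun ω σ u => (T ω σ u).transpose) SX A (fun ω a b => D ω b a) ρ where
  hasSum σ hσ u hu i j := by simpa using h.hasSum σ hσ u hu j i
  termAnalytic ω σ hσ i j := by simpa using h.termAnalytic ω σ hσ j i
  maj ω σ hσ u hu i j := by simpa using h.maj ω σ hσ u hu j i
  majSum S a b := by
    have := h.majSum S b a
    simpa [tdist1_comm b a] using this
  indep ω hω σ hσ := by rw [h.indep ω hω σ hσ]
  through ω hω y y' := by
    obtain ⟨z, hz, hle⟩ := h.through ω hω y' y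
    refine ⟨z, hz, ?_⟩
    have e1 : (toB6 (torusGeom Nf 0 0 0) 0 True).dist y z = tdist1 Nf y z := rfl
    have e2 : (toB6 (torusGeom Nf 0 0 0) 0 True).dist z y' = tdist1 Nf z y' := rfl
    have e3 : (toB6 (torusGeom Nf 0 0 0) 0 True).dist y' z = tdist1 Nf y' z := rfl
    have e4 : (toB6 (torusGeom Nf 0 0 0) 0 True).dist z y = tdist1 Nf z y := rfl
    rw [e1, e2]; rw [e3, e4] at hle
    rw [tdist1_comm y z, tdist1_comm z y']
    linarith
  A_nonneg := h.A_nonneg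
  D_nonneg ω a b := h.D_nonneg ω b a

/-- **CONSTANT SCALAR MULTIPLE** (`½`, `−1`, normalisations): terms `a·T_ω`, amplitudes `‖a‖A_ω`, constant `‖a‖K̄`.
[cite: Balaban1985BackgroundPropagators, (3.107)–(3.108) p.416] -/
theorem jointWalkExpansion_smul (h : JointWalkExpansion c locp locn K X R ε kap Kbar T SX A D ρ) (a : ℂ) :
    JointWalkExpansion c locp locn (fun σ u => a • K σ u) X R ε kap (‖a‖ * Kbar)
      (fun ω σ u => a • T ω σ u) SX (fun ω => ‖a‖ * A ω) D ρ where
  hasSum σ hσ u hu i j := by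
    simpa [Matrix.smul_apply, smul_eq_mul] using (h.hasSum σ hσ u hu i j).mul_left a
  termAnalytic ω σ hσ i j := by
    simpa [Matrix.smul_apply, smul_eq_mul] using (h.termAnalytic ω σ hσ i j).const_mul a
  maj ω σ hσ u hu i j := by
    rw [Matrix.smul_apply, smul_eq_mul, norm_mul, mul_assoc]
    exact mul_le_mul_of_nonneg_left (h.maj ω σ hσ u hu i j) (norm_nonneg a)
  majSum S x y := by
    have hs := h.majSum S x y
    calc ∑ ω ∈ S, ‖a‖ * A ω * Real.exp (-((ρ - ε) * D ω x y))
        = ‖a‖ * ∑ ω ∈ S, A ω * Real.exp (-((ρ - ε) * D ω x y)) := by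
          rw [Finset.mul_sum]; exact Finset.sum_congr rfl fun ω _ => by ring
      _ ≤ ‖a‖ * (Kbar * Real.exp (-(kap * tdist1 Nf x y))) := mul_le_mul_of_nonneg_left hs (norm_nonneg a)
      _ = ‖a‖ * Kbar * Real.exp (-(kap * tdist1 Nf x y)) := by ring
  indep ω hω σ hσ := by rw [h.indep ω hω σ hσ]
  through := h.through
  A_nonneg ω := mul_nonneg (norm_nonneg a) (h.A_nonneg ω)
  D_nonneg := h.D_nonneg

/-- **NEGATION** (the signs of (2.5)): terms `−T_ω`, same constants. [cite: Balaban1988RG2Cluster, (2.5) p.12] -/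
theorem jointWalkExpansion_neg (h : JointWalkExpansion c locp locn K X R ε kap Kbar T SX A D ρ) :
    JointWalkExpansion c locp locn (fun σ u => -K σ u) X R ε kap Kbar (fun ω σ u => -T ω σ u) SX A D ρ where
  hasSum σ hσ u hu i j := by simpa using (h.hasSum σ hσ u hu i j).neg
  termAnalytic ω σ hσ i j := by simpa using (h.termAnalytic ω σ hσ i j).neg
  maj ω σ hσ u hu i j := by simpa using h.maj ω σ hσ u hu i j
  majSum := h.majSum
  indep ω hω σ hσ := by rw [h.indep ω hω σ hσ]
  through := h.through
  A_nonneg := h.A_nonneg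
  D_nonneg := h.D_nonneg

end OneFactor

/-! ## §3. SUM: two walk-expanded families on the same carriers add to a walk-expanded family on `W₁ ⊕ W₂` -/

section Add

variable {d N' : ℕ} {p n : Type}
variable {E : Type*} [NormedAddCommGroup E] [NormedSpace ℂ E]
variable {c₀ : B13.Consts} {locp : p → UT Nf} {locn : n → UT Nf} {X : Finset (UT Nf)} {R : ℝ}
variable {K₁ K₂ : (TPt d N' → ℂ) → E → Matrix p n ℂ}
variable {W₁ W₂ : Type} {T₁ : W₁ → (TPt d N' → ℂ) → E → Matrix p n ℂ} {T₂ : W₂ → (TPt d N' → ℂ) → E → Matrix p n ℂ}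
variable {SX₁ : Set W₁} {SX₂ : Set W₂}
variable {A₁ : W₁ → ℝ} {A₂ : W₂ → ℝ} {D₁ : W₁ → UT Nf → UT Nf → ℝ} {D₂ : W₂ → UT Nf → UT Nf → ℝ}
variable {ρ₁ ρ₂ ε₁ ε₂ κ₁ κ₂ Kbar₁ Kbar₂ ρ ε κ : ℝ}

/-- **THE SUM OF TWO JOINT WALK EXPANSIONS IS A JOINT WALK EXPANSION** (Literature home of the Summit-side
`Gaps.D4WalkSum.jointWalkExpansion_add`; same locators, σ-region and ball; rates `ρ ≤ ρ₁, ρ₂`, `ρᵢ − εᵢ ≤ ρ − ε`,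
`κ ≤ κ₁, κ₂`, `0 ≤ K̄ᵢ`): terms on `W₁ ⊕ W₂`, σ-carrying sub-family ∕ amplitudes ∕ distances by `Sum.elim`, constant
`K̄₁ + K̄₂` — (2.5)∕(2.9): the operators determining `Δ_k` are sums of walk-expanded pieces. [cite: Balaban1988RG2Cluster, (2.5) p.12, p.13; Balaban1985BackgroundPropagators, (3.107)–(3.108) p.416, p.422] -/
theorem jointWalkExpansion_add
    (h₁ : JointWalkExpansion c₀ locp locn K₁ X R ε₁ κ₁ Kbar₁ T₁ SX₁ A₁ D₁ ρ₁)
    (h₂ : JointWalkExpansion c₀ locp locn K₂ X R ε₂ κ₂ Kbar₂ T₂ SX₂ A₂ D₂ ρ₂)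
    (hρ₁ : ρ ≤ ρ₁) (hρ₂ : ρ ≤ ρ₂) (hw₁ : ρ₁ - ε₁ ≤ ρ - ε) (hw₂ : ρ₂ - ε₂ ≤ ρ - ε)
    (hκ₁ : κ ≤ κ₁) (hκ₂ : κ ≤ κ₂) (hK₁ : 0 ≤ Kbar₁) (hK₂ : 0 ≤ Kbar₂) :
    JointWalkExpansion c₀ locp locn (fun σ₀ u => K₁ σ₀ u + K₂ σ₀ u) X R ε κ (Kbar₁ + Kbar₂)
      (fun (ω : W₁ ⊕ W₂) => Sum.elim T₁ T₂ ω) {ω | Sum.elim (· ∈ SX₁) (· ∈ SX₂) ω}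
      (fun ω => Sum.elim A₁ A₂ ω) (fun ω => Sum.elim D₁ D₂ ω) ρ where
  hasSum σ₀ hσ₀ u hu i j := by
    rw [Matrix.add_apply]
    exact HasSum.sum (f := fun ω : W₁ ⊕ W₂ => Sum.elim T₁ T₂ ω σ₀ u i j) (h₁.hasSum σ₀ hσ₀ u hu i j)
      (h₂.hasSum σ₀ hσ₀ u hu i j)
  termAnalytic ω σ₀ hσ₀ i j := by
    rcases ω with ω | ω
    · exact h₁.termAnalytic ω σ₀ hσ₀ i j
    · exact h₂.termAnalytic ω σ₀ hσ₀ i j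
  maj ω σ₀ hσ₀ u hu i j := by
    rcases ω with ω | ω
    · exact (h₁.maj ω σ₀ hσ₀ u hu i j).trans (maj_mono_rate (h₁.A_nonneg ω) (h₁.D_nonneg ω _ _) hρ₁)
    · exact (h₂.maj ω σ₀ hσ₀ u hu i j).trans (maj_mono_rate (h₂.A_nonneg ω) (h₂.D_nonneg ω _ _) hρ₂)
  majSum := by
    have g₁ : MajSumLe (g := toB6 (torusGeom Nf 0 0 0) 0 True) (fun ω a b => A₁ ω * Real.exp (-((ρ - ε) * D₁ ω a b)))
        (fun a b => Kbar₁ * Real.exp (-(κ * tdist1 Nf a b))) := by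
      intro S a b
      refine (Finset.sum_le_sum fun ω _ => maj_mono_rate (h₁.A_nonneg ω) (h₁.D_nonneg ω a b) hw₁).trans
        ((h₁.majSum S a b).trans (maj_mono_rate hK₁ (tdist1_nonneg a b) hκ₁))
    have g₂ : MajSumLe (g := toB6 (torusGeom Nf 0 0 0) 0 True) (fun ω a b => A₂ ω * Real.exp (-((ρ - ε) * D₂ ω a b)))
        (fun a b => Kbar₂ * Real.exp (-(κ * tdist1 Nf a b))) := by
      intro S a b
      refine (Finset.sum_le_sum fun ω _ => maj_mono_rate (h₂.A_nonneg ω) (h₂.D_nonneg ω a b) hw₂).trans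
        ((h₂.majSum S a b).trans (maj_mono_rate hK₂ (tdist1_nonneg a b) hκ₂))
    have g := majSumLe_sum g₁ g₂
    intro S a b
    have e : ∀ ω : W₁ ⊕ W₂, Sum.elim A₁ A₂ ω * Real.exp (-((ρ - ε) * Sum.elim D₁ D₂ ω a b)) =
        Sum.elim (fun ω a b => A₁ ω * Real.exp (-((ρ - ε) * D₁ ω a b)))
          (fun ω a b => A₂ ω * Real.exp (-((ρ - ε) * D₂ ω a b))) ω a b := by
      rintro (ω | ω) <;> rfl
    calc ∑ ω ∈ S, Sum.elim A₁ A₂ ω * Real.exp (-((ρ - ε) * Sum.elim D₁ D₂ ω a b))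
        = ∑ ω ∈ S, Sum.elim (fun ω a b => A₁ ω * Real.exp (-((ρ - ε) * D₁ ω a b)))
            (fun ω a b => A₂ ω * Real.exp (-((ρ - ε) * D₂ ω a b))) ω a b := Finset.sum_congr rfl fun ω _ => e ω
      _ ≤ Kbar₁ * Real.exp (-(κ * tdist1 Nf a b)) + Kbar₂ * Real.exp (-(κ * tdist1 Nf a b)) := g S a b
      _ = (Kbar₁ + Kbar₂) * Real.exp (-(κ * tdist1 Nf a b)) := by ring
  indep ω hω σ₀ hσ₀ := by
    rcases ω with ω | ω
    · exact h₁.indep ω hω σ₀ hσ₀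
    · exact h₂.indep ω hω σ₀ hσ₀
  through ω hω := by
    rcases ω with ω | ω
    · exact h₁.through ω hω
    · exact h₂.through ω hω
  A_nonneg ω := by
    rcases ω with ω | ω
    · exact h₁.A_nonneg ω
    · exact h₂.A_nonneg ω
  D_nonneg ω a b := by
    rcases ω with ω | ω
    · exact h₁.D_nonneg ω a b
    · exact h₂.D_nonneg ω a b

/-- **Domination for the sum family** (`Sum.elim` of dominating distances dominates `d₁`). [cite: Balaban1984PropagatorsII, (2.54) p.233] -/
theorem domBy_add (hd₁ : ∀ ω, DomBy (toB6 (torusGeom Nf 0 0 0) 0 True) (D₁ ω))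
    (hd₂ : ∀ ω, DomBy (toB6 (torusGeom Nf 0 0 0) 0 True) (D₂ ω)) (ω : W₁ ⊕ W₂) :
    DomBy (toB6 (torusGeom Nf 0 0 0) 0 True) (Sum.elim D₁ D₂ ω) := by
  rcases ω with ω | ω
  · exact hd₁ ω
  · exact hd₂ ω

/-- **The same package, both summands** (the form a uniform package uses): both expansions at `(ρ₀, ε₀, κ₀)` ⟹ the
sum at `(ρ₀, ε₀, κ₀)` with constant `K̄₁ + K̄₂`. [cite: Balaban1985BackgroundPropagators, (3.108) p.416] -/
theorem jointWalkExpansion_add_same {ρ₀ ε₀ κ₀ : ℝ}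
    (h₁ : JointWalkExpansion c₀ locp locn K₁ X R ε₀ κ₀ Kbar₁ T₁ SX₁ A₁ D₁ ρ₀)
    (h₂ : JointWalkExpansion c₀ locp locn K₂ X R ε₀ κ₀ Kbar₂ T₂ SX₂ A₂ D₂ ρ₀)
    (hK₁ : 0 ≤ Kbar₁) (hK₂ : 0 ≤ Kbar₂) :
    JointWalkExpansion c₀ locp locn (fun σ₀ u => K₁ σ₀ u + K₂ σ₀ u) X R ε₀ κ₀ (Kbar₁ + Kbar₂)
      (fun (ω : W₁ ⊕ W₂) => Sum.elim T₁ T₂ ω) {ω | Sum.elim (· ∈ SX₁) (· ∈ SX₂) ω}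
      (fun ω => Sum.elim A₁ A₂ ω) (fun ω => Sum.elim D₁ D₂ ω) ρ₀ :=
  jointWalkExpansion_add h₁ h₂ le_rfl le_rfl le_rfl le_rfl le_rfl le_rfl hK₁ hK₂

end Add

/-! ## §4. PRODUCT: «we replace each operator by its random walk expansion» — the product of two walk-expanded families
is walk-expanded, terms indexed by PAIRS of walks, the concatenated distance (3.93), the junction sum paid by (2.61) -/

section Mul

variable {d N' : ℕ} {p n q : Type} [Fintype n]
variable {E : Type*} [NormedAddCommGroup E] [NormedSpace ℂ E]
variable {c₀ : B13.Consts} {locp : p → UT Nf} {locn : n → UT Nf} {locq : q → UT Nf} {X : Finset (UT Nf)} {R : ℝ}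
variable {K₁ : (TPt d N' → ℂ) → E → Matrix p n ℂ} {K₂ : (TPt d N' → ℂ) → E → Matrix n q ℂ}
variable {W₁ W₂ : Type} {T₁ : W₁ → (TPt d N' → ℂ) → E → Matrix p n ℂ} {T₂ : W₂ → (TPt d N' → ℂ) → E → Matrix n q ℂ}
variable {SX₁ : Set W₁} {SX₂ : Set W₂}
variable {A₁ : W₁ → ℝ} {A₂ : W₂ → ℝ} {D₁ : W₁ → UT Nf → UT Nf → ℝ} {D₂ : W₂ → UT Nf → UT Nf → ℝ}
variable {ρ₁ ρ₂ ε₁ ε₂ κ₁ κ₂ Kbar₁ Kbar₂ ρ ε κ σ c σ' c' : ℝ} {m : ℕ}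

/-- The entrywise `HasSum` of the product family from the factors' expansions (absolute summability from the majorants,
`HasSum.mul` per middle index, `hasSum_sum` over the finite middle index). [cite: Balaban1985BackgroundPropagators, (3.107) p.416, p.422] -/
theorem hasSum_mul_entry
    (h₁ : JointWalkExpansion c₀ locp locn K₁ X R ε₁ κ₁ Kbar₁ T₁ SX₁ A₁ D₁ ρ₁)
    (h₂ : JointWalkExpansion c₀ locn locq K₂ X R ε₂ κ₂ Kbar₂ T₂ SX₂ A₂ D₂ ρ₂) (hε₁ : 0 ≤ ε₁) (hε₂ : 0 ≤ ε₂)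
    {σ₀ : TPt d N' → ℂ} (hσ₀ : ∀ j, ‖σ₀ j‖ ≤ Real.exp c₀.κ₁) {u : E} (hu : u ∈ ball (0 : E) R) (i : p) (j : q) :
    HasSum (fun ω : W₁ × W₂ => (T₁ ω.1 σ₀ u * T₂ ω.2 σ₀ u) i j) ((K₁ σ₀ u * K₂ σ₀ u) i j) := by
  have e : (fun ω : W₁ × W₂ => (T₁ ω.1 σ₀ u * T₂ ω.2 σ₀ u) i j) =
      fun ω => ∑ k, T₁ ω.1 σ₀ u i k * T₂ ω.2 σ₀ u k j := funext fun ω => Matrix.mul_apply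
  rw [e, Matrix.mul_apply]
  refine hasSum_sum fun k _ => ?_
  have ha0 : ∀ ω, 0 ≤ A₁ ω * Real.exp (-(ρ₁ * D₁ ω (locp i) (locn k))) :=
    fun ω => mul_nonneg (h₁.A_nonneg ω) (Real.exp_nonneg _)
  have hb0 : ∀ ω, 0 ≤ A₂ ω * Real.exp (-(ρ₂ * D₂ ω (locn k) (locq j))) :=
    fun ω => mul_nonneg (h₂.A_nonneg ω) (Real.exp_nonneg _)
  have ha : Summable fun ω => A₁ ω * Real.exp (-(ρ₁ * D₁ ω (locp i) (locn k))) :=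
    summable_majorant_of_majSumLe h₁.A_nonneg h₁.D_nonneg (by linarith) h₁.majSum (locp i) (locn k)
  have hb : Summable fun ω => A₂ ω * Real.exp (-(ρ₂ * D₂ ω (locn k) (locq j))) :=
    summable_majorant_of_majSumLe h₂.A_nonneg h₂.D_nonneg (by linarith) h₂.majSum (locn k) (locq j)
  let f : W₁ → ℂ := fun ω => T₁ ω σ₀ u i k
  let g : W₂ → ℂ := fun ω => T₂ ω σ₀ u k j
  have hfg : Summable fun x : W₁ × W₂ => f x.1 * g x.2 := by
    refine Summable.of_norm_bounded (ha.mul_of_nonneg hb ha0 hb0) fun x => ?_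
    exact (norm_mul_le (f x.1) (g x.2)).trans
      (mul_le_mul (h₁.maj x.1 σ₀ hσ₀ u hu i k) (h₂.maj x.2 σ₀ hσ₀ u hu k j) (norm_nonneg _) (ha0 x.1))
  exact HasSum.mul (f := f) (g := g) (h₁.hasSum σ₀ hσ₀ u hu i k) (h₂.hasSum σ₀ hσ₀ u hu k j) hfg

/-- Termwise analyticity of a product term in the configuration (an entry of `T₁ω₁(σ,u)·T₂ω₂(σ,u)` is a finite sum of
products of analytic entries — [II] p. 15: the quadratic forms are analytic functions of `(U, J)`). [cite: Balaban1988RG2Cluster, p.15; Balaban1985BackgroundPropagators, Thm 3.10 p.416] -/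
theorem differentiableOn_mul_entry
    (h₁ : JointWalkExpansion c₀ locp locn K₁ X R ε₁ κ₁ Kbar₁ T₁ SX₁ A₁ D₁ ρ₁)
    (h₂ : JointWalkExpansion c₀ locn locq K₂ X R ε₂ κ₂ Kbar₂ T₂ SX₂ A₂ D₂ ρ₂) (ω : W₁ × W₂)
    {σ₀ : TPt d N' → ℂ} (hσ₀ : ∀ j, ‖σ₀ j‖ ≤ Real.exp c₀.κ₁) (i : p) (j : q) :
    DifferentiableOn ℂ (fun u => (T₁ ω.1 σ₀ u * T₂ ω.2 σ₀ u) i j) (ball (0 : E) R) := by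
  have e : (fun u => (T₁ ω.1 σ₀ u * T₂ ω.2 σ₀ u) i j) = fun u => ∑ k, T₁ ω.1 σ₀ u i k * T₂ ω.2 σ₀ u k j :=
    funext fun u => Matrix.mul_apply
  rw [e]
  exact DifferentiableOn.fun_sum fun k _ => (h₁.termAnalytic ω.1 σ₀ hσ₀ i k).mul (h₂.termAnalytic ω.2 σ₀ hσ₀ k j)

/-- **THE PRODUCT OF TWO JOINT WALK EXPANSIONS IS A JOINT WALK EXPANSION** ([B9] p. 422 *"we replace each operator …
by its random walk expansion"*; the form in which (2.7)∕(2.14)'s `C*Δ_k(σ)C_{Z₀ᶜ}`, `C*_{Z₀ᶜ}Δ_k(σ)C_{Z₀ᶜ}`,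
`Δ^{(k)}(Z₀,σ)` inherit their expansions from the primitives').  DATA: expansions of `K₁` (rows `p`, columns `n`;
package `(ρ₁, ε₁, κ₁, K̄₁)`, `ε₁ ≥ 0`) and of `K₂` (rows `n`, columns `q`; `(ρ₂, ε₂, κ₂, K̄₂)`, `ε₂ ≥ 0`) on the same
polydisc × ball through the same σ-region `X`; BOTH walk distances dominating `d₁` ((2.54): true of every (3.93)
distance); fibre multiplicity `m` of the middle locator; row sums (2.61) at the junction rate `σ ≥ 0` (constant `c ≥ 0`)
and at `σ′` (constant `c′`).  RATES: per-term `0 ≤ ρ`, `ρ + σ ≤ ρ₁` (the LEFT factor's excess pays the junction),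
`ρ ≤ ρ₂`; drop `ε` with `ρᵢ − εᵢ ≤ ρ − ε` (the product is summed inside both factors' drop windows); torus rate
`0 ≤ κ ≤ κ₂`, `κ + σ′ ≤ κ₁`.  CONCLUSION: `K₁K₂ = Σ_{(ω₁,ω₂)} T₁ω₁·T₂ω₂` is a joint walk expansion with terms on
`W₁ × W₂`, σ-carrying sub-family `{ω₁ ∈ SX₁ ∨ ω₂ ∈ SX₂}` (a product term takes its `σ = 0` value iff both factors do;
a σ-carrying product passes through `X` because one factor does, `through_infConv_left∕right`), amplitudes
`(mc)·A₁A₂`, walk distance `D₁ □ D₂`, rate `ρ`, constant `(mc)·K̄₁K̄₂c′`. [cite: Balaban1985BackgroundPropagators, (3.92)–(3.94) p.410, (3.107)–(3.108) p.416, p.422, Thm 3.12 p.423; Balaban1988RG2Cluster, (1.11) p.5, p.13, p.15; Balaban1984PropagatorsII, (2.54) p.233, (2.61) p.234] -/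
theorem jointWalkExpansion_mul
    (h₁ : JointWalkExpansion c₀ locp locn K₁ X R ε₁ κ₁ Kbar₁ T₁ SX₁ A₁ D₁ ρ₁)
    (h₂ : JointWalkExpansion c₀ locn locq K₂ X R ε₂ κ₂ Kbar₂ T₂ SX₂ A₂ D₂ ρ₂) (hε₁ : 0 ≤ ε₁) (hε₂ : 0 ≤ ε₂)
    (hdom₁ : ∀ ω, DomBy (toB6 (torusGeom Nf 0 0 0) 0 True) (D₁ ω))
    (hdom₂ : ∀ ω, DomBy (toB6 (torusGeom Nf 0 0 0) 0 True) (D₂ ω))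
    (hfib : ∀ y : UT Nf, (Finset.univ.filter fun k => locn k = y).card ≤ m)
    (hrow : RowSum (toB6 (torusGeom Nf 0 0 0) 0 True) σ c) (hrow' : RowSum (toB6 (torusGeom Nf 0 0 0) 0 True) σ' c')
    (hρ : 0 ≤ ρ) (hσ : 0 ≤ σ) (hρ₁ : ρ + σ ≤ ρ₁) (hρ₂ : ρ ≤ ρ₂) (hw₁ : ρ₁ - ε₁ ≤ ρ - ε)
    (hw₂ : ρ₂ - ε₂ ≤ ρ - ε) (hK₁ : 0 ≤ Kbar₁) (hK₂ : 0 ≤ Kbar₂) (hκ : 0 ≤ κ) (hκ₂ : κ ≤ κ₂) (hκ₁ : κ + σ' ≤ κ₁)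
    (hc : 0 ≤ c) :
    JointWalkExpansion c₀ locp locq (fun σ₀ u => K₁ σ₀ u * K₂ σ₀ u) X R ε κ ((m * c) * Kbar₁ * Kbar₂ * c')
      (fun (ω : W₁ × W₂) σ₀ u => T₁ ω.1 σ₀ u * T₂ ω.2 σ₀ u) {ω | ω.1 ∈ SX₁ ∨ ω.2 ∈ SX₂}
      (fun ω => (m * c) * (A₁ ω.1 * A₂ ω.2))
      (fun ω => infConv (g := toB6 (torusGeom Nf 0 0 0) 0 True) (D₁ ω.1) (D₂ ω.2)) ρ where
  hasSum σ₀ hσ₀ u hu i j := hasSum_mul_entry h₁ h₂ hε₁ hε₂ hσ₀ hu i j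
  termAnalytic ω σ₀ hσ₀ i j := differentiableOn_mul_entry h₁ h₂ ω hσ₀ i j
  maj ω σ₀ hσ₀ u hu i j :=
    norm_mul_entry_le_of_walks locp locn locq hfib (h₁.A_nonneg ω.1) (h₂.A_nonneg ω.2) hρ hρ₂ hσ hρ₁ (hdom₁ ω.1)
      (h₂.D_nonneg ω.2) hrow (fun i k => h₁.maj ω.1 σ₀ hσ₀ u hu i k) (fun k j => h₂.maj ω.2 σ₀ hσ₀ u hu k j) i j
  majSum :=
    majSumLe_mul (Nf := Nf) (C := m * c) h₁.A_nonneg h₂.A_nonneg h₁.D_nonneg h₂.D_nonneg hw₁ hw₂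
      (mul_nonneg (Nat.cast_nonneg m) hc) hK₁ hK₂ hκ hκ₂ hκ₁ hrow' h₁.majSum h₂.majSum
  indep ω hω σ₀ hσ₀ := by
    have h1 : ω.1 ∉ SX₁ := fun h => hω (Or.inl h)
    have h2 : ω.2 ∉ SX₂ := fun h => hω (Or.inr h)
    show T₁ ω.1 σ₀ 0 * T₂ ω.2 σ₀ 0 = T₁ ω.1 0 0 * T₂ ω.2 0 0
    rw [h₁.indep ω.1 h1 σ₀ hσ₀, h₂.indep ω.2 h2 σ₀ hσ₀]
  through ω hω := by
    rcases hω with hω | hω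
    · exact through_infConv_left (htri_torusGeom 0 0 0 0 True) (h₁.through ω.1 hω) (hdom₂ ω.2)
    · exact through_infConv_right (htri_torusGeom 0 0 0 0 True) (hdom₁ ω.1) (h₂.through ω.2 hω)
  A_nonneg ω := mul_nonneg (mul_nonneg (Nat.cast_nonneg m) hc) (mul_nonneg (h₁.A_nonneg ω.1) (h₂.A_nonneg ω.2))
  D_nonneg ω a b := le_infConv fun z => add_nonneg (h₁.D_nonneg ω.1 a z) (h₂.D_nonneg ω.2 z b)

/-- **The product, MIRROR form** (the RIGHT factor pays the junction: `ρ ≤ ρ₁`, `ρ + σ ≤ ρ₂`; everything else as in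
`jointWalkExpansion_mul`) — the form used when the left factor has no rate to spare. [cite: Balaban1985BackgroundPropagators, (3.92)–(3.94) p.410, p.422] -/
theorem jointWalkExpansion_mul_mirror
    (h₁ : JointWalkExpansion c₀ locp locn K₁ X R ε₁ κ₁ Kbar₁ T₁ SX₁ A₁ D₁ ρ₁)
    (h₂ : JointWalkExpansion c₀ locn locq K₂ X R ε₂ κ₂ Kbar₂ T₂ SX₂ A₂ D₂ ρ₂) (hε₁ : 0 ≤ ε₁) (hε₂ : 0 ≤ ε₂)
    (hdom₁ : ∀ ω, DomBy (toB6 (torusGeom Nf 0 0 0) 0 True) (D₁ ω))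
    (hdom₂ : ∀ ω, DomBy (toB6 (torusGeom Nf 0 0 0) 0 True) (D₂ ω))
    (hfib : ∀ y : UT Nf, (Finset.univ.filter fun k => locn k = y).card ≤ m)
    (hrow : RowSum (toB6 (torusGeom Nf 0 0 0) 0 True) σ c) (hrow' : RowSum (toB6 (torusGeom Nf 0 0 0) 0 True) σ' c')
    (hρ : 0 ≤ ρ) (hσ : 0 ≤ σ) (hρ₁ : ρ ≤ ρ₁) (hρ₂ : ρ + σ ≤ ρ₂) (hw₁ : ρ₁ - ε₁ ≤ ρ - ε)
    (hw₂ : ρ₂ - ε₂ ≤ ρ - ε) (hK₁ : 0 ≤ Kbar₁) (hK₂ : 0 ≤ Kbar₂) (hκ : 0 ≤ κ) (hκ₂ : κ ≤ κ₂) (hκ₁ : κ + σ' ≤ κ₁)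
    (hc : 0 ≤ c) :
    JointWalkExpansion c₀ locp locq (fun σ₀ u => K₁ σ₀ u * K₂ σ₀ u) X R ε κ ((m * c) * Kbar₁ * Kbar₂ * c')
      (fun (ω : W₁ × W₂) σ₀ u => T₁ ω.1 σ₀ u * T₂ ω.2 σ₀ u) {ω | ω.1 ∈ SX₁ ∨ ω.2 ∈ SX₂}
      (fun ω => (m * c) * (A₁ ω.1 * A₂ ω.2))
      (fun ω => infConv (g := toB6 (torusGeom Nf 0 0 0) 0 True) (D₁ ω.1) (D₂ ω.2)) ρ where
  hasSum σ₀ hσ₀ u hu i j := hasSum_mul_entry h₁ h₂ hε₁ hε₂ hσ₀ hu i j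
  termAnalytic ω σ₀ hσ₀ i j := differentiableOn_mul_entry h₁ h₂ ω hσ₀ i j
  maj ω σ₀ hσ₀ u hu i j :=
    norm_mul_entry_le_of_walks_mirror locp locn locq hfib (h₁.A_nonneg ω.1) (h₂.A_nonneg ω.2) hρ hρ₁ hσ hρ₂
      (h₁.D_nonneg ω.1) (hdom₂ ω.2) hrow (fun i k => h₁.maj ω.1 σ₀ hσ₀ u hu i k)
      (fun k j => h₂.maj ω.2 σ₀ hσ₀ u hu k j) i j
  majSum :=
    majSumLe_mul (Nf := Nf) (C := m * c) h₁.A_nonneg h₂.A_nonneg h₁.D_nonneg h₂.D_nonneg hw₁ hw₂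
      (mul_nonneg (Nat.cast_nonneg m) hc) hK₁ hK₂ hκ hκ₂ hκ₁ hrow' h₁.majSum h₂.majSum
  indep ω hω σ₀ hσ₀ := by
    have h1 : ω.1 ∉ SX₁ := fun h => hω (Or.inl h)
    have h2 : ω.2 ∉ SX₂ := fun h => hω (Or.inr h)
    show T₁ ω.1 σ₀ 0 * T₂ ω.2 σ₀ 0 = T₁ ω.1 0 0 * T₂ ω.2 0 0
    rw [h₁.indep ω.1 h1 σ₀ hσ₀, h₂.indep ω.2 h2 σ₀ hσ₀]
  through ω hω := by
    rcases hω with hω | hω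
    · exact through_infConv_left (htri_torusGeom 0 0 0 0 True) (h₁.through ω.1 hω) (hdom₂ ω.2)
    · exact through_infConv_right (htri_torusGeom 0 0 0 0 True) (hdom₁ ω.1) (h₂.through ω.2 hω)
  A_nonneg ω := mul_nonneg (mul_nonneg (Nat.cast_nonneg m) hc) (mul_nonneg (h₁.A_nonneg ω.1) (h₂.A_nonneg ω.2))
  D_nonneg ω a b := le_infConv fun z => add_nonneg (h₁.D_nonneg ω.1 a z) (h₂.D_nonneg ω.2 z b)

/-- **Domination for the product family**: the concatenated distance `D₁ □ D₂` dominates `d₁` ((2.54)) — so products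
can be iterated. [cite: Balaban1984PropagatorsII, (2.54) p.233; Balaban1985BackgroundPropagators, (3.93) p.410] -/
theorem domBy_mul (hdom₁ : ∀ ω, DomBy (toB6 (torusGeom Nf 0 0 0) 0 True) (D₁ ω))
    (hdom₂ : ∀ ω, DomBy (toB6 (torusGeom Nf 0 0 0) 0 True) (D₂ ω)) (ω : W₁ × W₂) :
    DomBy (toB6 (torusGeom Nf 0 0 0) 0 True)
      (infConv (g := toB6 (torusGeom Nf 0 0 0) 0 True) (D₁ ω.1) (D₂ ω.2)) :=
  domBy_infConv (htri_torusGeom 0 0 0 0 True) (hdom₁ ω.1) (hdom₂ ω.2)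

/-- **THE PRODUCT WITH THE ROW SUMS DISCHARGED ON EVERY TORUS** (`B13LocalKernelWalks.rowSum_torus`: (2.61) at rate
`μ > 0` holds on the one-scale torus of every size with the constant `c₀(1,μ)^ν`): both factors at ONE package
`(ρ₀, ε₀, κ₀, ·)` with `0 < μ ≤ ε₀`, `μ ≤ ρ₀`, `μ ≤ κ₀`; the product at `(ρ₀ − μ, ε₀ − μ, κ₀ − μ)` with amplitude factor
`m·c₀(1,μ)^ν` and constant `m·c₀(1,μ)^ν·K̄₁K̄₂·c₀(1,μ)^ν` — NO DEPENDENCE ON THE TORUS SIZE `Nf`.  Each product costs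
one junction rate `μ` off the per-term rate, the drop window and the torus rate (cf. the RATE LEDGER of
`B13JointWalkExpansion`). [cite: Balaban1985BackgroundPropagators, (3.92)–(3.94) p.410, p.422; Balaban1984PropagatorsII, Lemma 2.1 (2.61) p.234] -/
theorem jointWalkExpansion_mul_torus {ρ₀ ε₀ κ₀ μ : ℝ}
    (h₁ : JointWalkExpansion c₀ locp locn K₁ X R ε₀ κ₀ Kbar₁ T₁ SX₁ A₁ D₁ ρ₀)
    (h₂ : JointWalkExpansion c₀ locn locq K₂ X R ε₀ κ₀ Kbar₂ T₂ SX₂ A₂ D₂ ρ₀)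
    (hdom₁ : ∀ ω, DomBy (toB6 (torusGeom Nf 0 0 0) 0 True) (D₁ ω))
    (hdom₂ : ∀ ω, DomBy (toB6 (torusGeom Nf 0 0 0) 0 True) (D₂ ω))
    (hfib : ∀ y : UT Nf, (Finset.univ.filter fun k => locn k = y).card ≤ m)
    (hμ : 0 < μ) (hμε : μ ≤ ε₀) (hμρ : μ ≤ ρ₀) (hμκ : μ ≤ κ₀) (hK₁ : 0 ≤ Kbar₁) (hK₂ : 0 ≤ Kbar₂) :
    JointWalkExpansion c₀ locp locq (fun σ₀ u => K₁ σ₀ u * K₂ σ₀ u) X R (ε₀ - μ) (κ₀ - μ)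
      ((m * B6.c0 1 μ ^ ν) * Kbar₁ * Kbar₂ * B6.c0 1 μ ^ ν)
      (fun (ω : W₁ × W₂) σ₀ u => T₁ ω.1 σ₀ u * T₂ ω.2 σ₀ u) {ω | ω.1 ∈ SX₁ ∨ ω.2 ∈ SX₂}
      (fun ω => (m * B6.c0 1 μ ^ ν) * (A₁ ω.1 * A₂ ω.2))
      (fun ω => infConv (g := toB6 (torusGeom Nf 0 0 0) 0 True) (D₁ ω.1) (D₂ ω.2)) (ρ₀ - μ) :=
  jointWalkExpansion_mul h₁ h₂ (hμ.le.trans hμε) (hμ.le.trans hμε) hdom₁ hdom₂ hfib (rowSum_torus Nf hμ) (rowSum_torus Nf hμ)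
    (by linarith) hμ.le (by linarith) (by linarith) (by linarith) (by linarith) hK₁ hK₂ (by linarith)
    (by linarith) (by linarith) (pow_nonneg (B6RandomWalk.c0_nonneg 1 μ) ν)

end Mul

/-! ## §5. ACCRETIVITY AT COMPLEX `(σ, 𝐔, 𝐉)` BY THE PERTURBATIVE ARGUMENT OF p. 15 — from the SAME walk data and the
positivity of the reference operator at `(U, 0)` -/

section Accretive

variable {d N' : ℕ} {Λ : Type} [Fintype Λ] {n : Type}
variable {E : Type*} [NormedAddCommGroup E] [NormedSpace ℂ E]
variable {c₀ : B13.Consts} {loc : Λ → UT Nf} {locn : n → UT Nf} {X : Finset (UT Nf)} {R ε kap Kbar : ℝ}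
variable {W : Type} {SX : Set W} {A : W → ℝ} {D : W → UT Nf → UT Nf → ℝ} {ρ : ℝ}

omit [Fintype Λ] in
/-- **The full (2.16)-shape difference to the reference value from ONE joint walk expansion**: for `σ` on the polydisc
and `‖u‖ ≤ α < R`, `‖(K(σ,u) − K(0,0))(i,j)‖ ≤ 2K̄(e^{−εR_σ} + α/R)·e^{−κd₁(loc i, loc j)}` — the σ-part through the
far set `X` (`JointWalkExpansion.sub_ref_sigma`, print's `O(1)e^{−⅓δ₀M}`) plus the u-part by analyticity on the bigger
ball (`B13Eq216AnalyticStep.entry_sub_le_of_differentiableOn` with the expansion's own majorants, print's `O(α₀ + α₁)`).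
[cite: Balaban1988RG2Cluster, (2.16) p.16, p.13, p.15] -/
theorem sub_ref_entry_le_of_jointWalkExpansion {K : (TPt d N' → ℂ) → E → Matrix Λ n ℂ}
    {T : W → (TPt d N' → ℂ) → E → Matrix Λ n ℂ}
    (h : JointWalkExpansion c₀ loc locn K X R ε kap Kbar T SX A D ρ) (hR : 0 < R) (hε : 0 ≤ ε)
    {Rσ α : ℝ} (hfar : ∀ i : Λ, ∀ z ∈ X, Rσ ≤ tdist1 Nf (loc i) z) (hαR : α < R)
    {σ₀ : TPt d N' → ℂ} (hσ₀ : ∀ j, ‖σ₀ j‖ ≤ Real.exp c₀.κ₁) {u : E} (hu : ‖u‖ ≤ α) (i : Λ) (j : n) :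
    ‖(K σ₀ u - K 0 0) i j‖ ≤
      2 * Kbar * (Real.exp (-(ε * Rσ)) + α / R) * Real.exp (-(kap * tdist1 Nf (loc i) (locn j))) := by
  have huR : u ∈ ball (0 : E) R := by rw [mem_ball, dist_zero_right]; exact hu.trans_lt hαR
  have hK : 0 ≤ Kbar :=
    (mul_nonneg_iff_of_pos_right (Real.exp_pos _)).1 ((norm_nonneg _).trans (h.majorants hε σ₀ hσ₀ u huR i j))
  -- the u-part at fixed σ: analyticity + the uniform majorant
  have h1 : ‖(K σ₀ u - K σ₀ 0) i j‖ ≤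
      2 * Kbar / R * ‖u‖ * Real.exp (-(kap * tdist1 Nf (loc i) (locn j))) :=
    entry_sub_le_of_differentiableOn (K := K σ₀) hR (fun i j => (Real.exp_pos _).le) (h.analyticOnBall hε σ₀ hσ₀)
      (fun w hw i j => h.majorants hε σ₀ hσ₀ w hw i j) huR i j
  -- the σ-part at the reference configuration: the far sub-family
  have h2 : ‖(K σ₀ 0 - K 0 0) i j‖ ≤
      (2 * Kbar * Real.exp (-(ε * Rσ))) * Real.exp (-(kap * tdist1 Nf (loc i) (locn j))) :=
    h.sub_ref_sigma hR hε hfar σ₀ hσ₀ i j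
  have hsplit : (K σ₀ u - K 0 0) i j = (K σ₀ u - K σ₀ 0) i j + (K σ₀ 0 - K 0 0) i j := by
    simp only [Matrix.sub_apply]; ring
  have hexp : 0 ≤ Real.exp (-(kap * tdist1 Nf (loc i) (locn j))) := (Real.exp_pos _).le
  have h3 : 2 * Kbar / R * ‖u‖ ≤ 2 * Kbar * (α / R) := by
    rw [show 2 * Kbar * (α / R) = 2 * Kbar / R * α by ring]
    exact mul_le_mul_of_nonneg_left hu (by positivity)
  calc ‖(K σ₀ u - K 0 0) i j‖ ≤ ‖(K σ₀ u - K σ₀ 0) i j‖ + ‖(K σ₀ 0 - K 0 0) i j‖ := by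
        rw [hsplit]; exact norm_add_le _ _
    _ ≤ 2 * Kbar * (α / R) * Real.exp (-(kap * tdist1 Nf (loc i) (locn j))) +
          (2 * Kbar * Real.exp (-(ε * Rσ))) * Real.exp (-(kap * tdist1 Nf (loc i) (locn j))) :=
        add_le_add (h1.trans (mul_le_mul_of_nonneg_right h3 hexp)) h2
    _ = 2 * Kbar * (Real.exp (-(ε * Rσ)) + α / R) * Real.exp (-(kap * tdist1 Nf (loc i) (locn j))) := by ring

/-- **ACCRETIVITY OF A WALK-EXPANDED SQUARE KERNEL AT COMPLEX `(σ, 𝐔, 𝐉)`** — [II] p. 15: *"For the pair (U,0) the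
operators are symmetric, and the measure is positive, and then the estimates are simpler. The general case is handled by
a perturbative argument."*  If `P(σ,u)` carries a joint walk expansion through `X` on polydisc × `R`-ball (constant `K̄`,
drop `ε ≥ 0`, torus rate `κ`), its reference value `P(0,0)` is the complexification of a real `γ`-coercive `T₀`, the row
indices sit at distance `≥ R_σ` from `X`, and the volume sums at rate `κ` are `≤ c_V` (rows and columns), then for every
`σ` of the polydisc and every `‖u‖ < α < R`, `P(σ,u)` is `m`-ACCRETIVE with
`m = γ − 2K̄(e^{−εR_σ} + α/R)·c_V` (`B13Sqrt27Accretive.accretive_of_coercive_add` on the (2.16)-shape perturbation) —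
the two accretivity fields `TermWalks.product`∕`.accA` of `NodeOLettersOfWalksAcross` from the walk data + positivity at
`(U,0)`; `m > 0` is print's two smallness sources (`M` large, the bigger analyticity space).
[cite: Balaban1988RG2Cluster, p.15, (2.16) p.16, p.13; Balaban1985BackgroundPropagators, Thm 3.11 p.417] -/
theorem accretive_of_jointWalkExpansion {P : (TPt d N' → ℂ) → E → Matrix Λ Λ ℂ}
    {T : W → (TPt d N' → ℂ) → E → Matrix Λ Λ ℂ}
    (h : JointWalkExpansion c₀ loc loc P X R ε kap Kbar T SX A D ρ) (hR : 0 < R) (hε : 0 ≤ ε) (hK : 0 ≤ Kbar)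
    {T₀ : Matrix Λ Λ ℝ} {γ : ℝ} (h0 : P 0 0 = T₀.map (algebraMap ℝ ℂ)) (hc : QGQInverse.Coercive T₀ γ)
    {Rσ α cV : ℝ} (hfar : ∀ i : Λ, ∀ z ∈ X, Rσ ≤ tdist1 Nf (loc i) z) (hα : 0 ≤ α) (hαR : α < R) (hcV : 0 ≤ cV)
    (hvol : ∀ i : Λ, ∑ j : Λ, Real.exp (-(kap * tdist1 Nf (loc i) (loc j))) ≤ cV)
    (hvol' : ∀ j : Λ, ∑ i : Λ, Real.exp (-(kap * tdist1 Nf (loc i) (loc j))) ≤ cV) :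
    ∀ σ₀ : TPt d N' → ℂ, (∀ j, ‖σ₀ j‖ ≤ Real.exp c₀.κ₁) → ∀ u ∈ ball (0 : E) α, ∀ v : Λ → ℂ,
      (γ - 2 * Kbar * (Real.exp (-(ε * Rσ)) + α / R) * cV) * ∑ i, ‖v i‖ ^ 2 ≤
        (∑ i, star (v i) * (P σ₀ u *ᵥ v) i).re := by
  intro σ₀ hσ₀ u hu v
  have huα : ‖u‖ ≤ α := by rw [mem_ball, dist_zero_right] at hu; exact hu.le
  set θ : ℝ := 2 * Kbar * (Real.exp (-(ε * Rσ)) + α / R) with hθ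
  have hθ0 : 0 ≤ θ := by rw [hθ]; have := hR.le; positivity
  have hent : ∀ i j, ‖(P σ₀ u - P 0 0) i j‖ ≤ θ * Real.exp (-(kap * tdist1 Nf (loc i) (loc j))) :=
    fun i j => sub_ref_entry_le_of_jointWalkExpansion h hR hε hfar hαR hσ₀ huα i j
  have hrow : ∀ i, ∑ j, ‖(P σ₀ u - P 0 0) i j‖ ≤ θ * cV := fun i =>
    calc ∑ j, ‖(P σ₀ u - P 0 0) i j‖ ≤ ∑ j, θ * Real.exp (-(kap * tdist1 Nf (loc i) (loc j))) :=
          Finset.sum_le_sum fun j _ => hent i j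
      _ = θ * ∑ j, Real.exp (-(kap * tdist1 Nf (loc i) (loc j))) := by rw [Finset.mul_sum]
      _ ≤ θ * cV := mul_le_mul_of_nonneg_left (hvol i) hθ0
  have hcol : ∀ j, ∑ i, ‖(P σ₀ u - P 0 0) i j‖ ≤ θ * cV := fun j =>
    calc ∑ i, ‖(P σ₀ u - P 0 0) i j‖ ≤ ∑ i, θ * Real.exp (-(kap * tdist1 Nf (loc i) (loc j))) :=
          Finset.sum_le_sum fun i _ => hent i j
      _ = θ * ∑ i, Real.exp (-(kap * tdist1 Nf (loc i) (loc j))) := by rw [Finset.mul_sum]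
      _ ≤ θ * cV := mul_le_mul_of_nonneg_left (hvol' j) hθ0
  have hdec : P σ₀ u = T₀.map (algebraMap ℝ ℂ) + (P σ₀ u - P 0 0) := by rw [← h0]; abel
  have key := accretive_of_coercive_add hc (mul_nonneg hθ0 hcV) hrow hcol v
  rw [← hdec] at key
  simpa [hθ, mul_assoc] using key

end Accretive

/-! ## §6. Non-vacuity with torus-uniform constants: the product of two one-step local families -/

section NonVacuity

variable {d N' : ℕ} {p n q : Type} [Fintype n]
variable {E : Type*} [NormedAddCommGroup E] [NormedSpace ℂ E]

/-- **THE HYPOTHESES OF `jointWalkExpansion_mul` ARE JOINTLY MET, WITH CONSTANTS INDEPENDENT OF THE TORUS**, by any two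
one-step local families of `B13LocalKernelWalks` sharing the middle carrier (`IsLocal` data `(λᵢ, rᵢ, m_{J,i}, n_{B,i})`,
middle locator of fibre multiplicity `m`, any rate unit `μ > 0`): each factor is a joint walk expansion at
`(ρ, ε, κ) = (5μ, 2μ, 2μ)` (`jointWalkExpansion_local_c0`, detour distances dominating `d₁` by `LocalTerms.domBy_dist`),
so the product is one at `(4μ, μ, μ)` with amplitudes `(m·c₀(1,μ)^ν)·A₁A₂` and constant
`(m·c₀(1,μ)^ν)·K̄₁K̄₂·c₀(1,μ)^ν`, `Aᵢ = λᵢe^{κ₁m_{J,i}}e^{5μrᵢ}`, `K̄ᵢ = Aᵢ·n_{B,i}·c₀(1,μ)^ν` — NO letter depends on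
`Nf`.  (A two-step instance of [B9] (3.107): walks of length 2.) [cite: Balaban1985BackgroundPropagators, (3.107)–(3.108) p.416, (3.93) p.410; Balaban1988RG2Cluster, (1.11) p.5; Balaban1984PropagatorsII, (2.61) p.234] -/
theorem jointWalkExpansion_mul_local (L₁ : B13LocalKernelWalks.LocalTerms d N' ν Nf p n E)
    (L₂ : B13LocalKernelWalks.LocalTerms d N' ν Nf n q E) {c : B13.Consts} (hκ₁ : 0 ≤ c.κ₁)
    {locp : p → UT Nf} {locn : n → UT Nf} {locq : q → UT Nf} {X : Finset (UT Nf)} {R lam₁ lam₂ r₁ r₂ : ℝ}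
    {mJ₁ mJ₂ nB₁ nB₂ : ℕ} (h₁ : L₁.IsLocal c locp locn X R lam₁ r₁ mJ₁ nB₁) (h₂ : L₂.IsLocal c locn locq X R lam₂ r₂ mJ₂ nB₂)
    (hlam₁ : 0 ≤ lam₁) (hlam₂ : 0 ≤ lam₂) {m : ℕ} (hfib : ∀ y : UT Nf, (Finset.univ.filter fun k => locn k = y).card ≤ m)
    {μ : ℝ} (hμ : 0 < μ) :
    JointWalkExpansion c locp locq (fun σ₀ u => L₁.kernel σ₀ u * L₂.kernel σ₀ u) X R μ μ
      ((m * B6.c0 1 μ ^ ν) * ((lam₁ * Real.exp (c.κ₁ * mJ₁) * Real.exp (5 * μ * r₁)) * (nB₁ * B6.c0 1 μ ^ ν)) *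
        ((lam₂ * Real.exp (c.κ₁ * mJ₂) * Real.exp (5 * μ * r₂)) * (nB₂ * B6.c0 1 μ ^ ν)) * B6.c0 1 μ ^ ν)
      (fun (ω : L₁.B × L₂.B) σ₀ u => L₁.term ω.1 σ₀ u * L₂.term ω.2 σ₀ u)
      {ω | ω.1 ∈ L₁.sigmaCarrying ∨ ω.2 ∈ L₂.sigmaCarrying}
      (fun _ => (m * B6.c0 1 μ ^ ν) *
        ((lam₁ * Real.exp (c.κ₁ * mJ₁) * Real.exp (5 * μ * r₁)) * (lam₂ * Real.exp (c.κ₁ * mJ₂) * Real.exp (5 * μ * r₂))))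
      (fun ω => infConv (g := toB6 (torusGeom Nf 0 0 0) 0 True) (L₁.dist ω.1) (L₂.dist ω.2)) (4 * μ) := by
  have e₁ := B13LocalKernelWalks.LocalTerms.jointWalkExpansion_local_c0 h₁ hκ₁ hlam₁ (ρ := 5 * μ) (ε := 2 * μ)
    (κ := 2 * μ) (μ := μ) (by linarith) (by linarith) hμ (by linarith)
  have e₂ := B13LocalKernelWalks.LocalTerms.jointWalkExpansion_local_c0 h₂ hκ₁ hlam₂ (ρ := 5 * μ) (ε := 2 * μ)
    (κ := 2 * μ) (μ := μ) (by linarith) (by linarith) hμ (by linarith)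
  have hc0 : 0 ≤ B6.c0 1 μ ^ ν := pow_nonneg (B6RandomWalk.c0_nonneg 1 μ) ν
  have hK₁ : 0 ≤ (lam₁ * Real.exp (c.κ₁ * mJ₁) * Real.exp (5 * μ * r₁)) * (nB₁ * B6.c0 1 μ ^ ν) := by positivity
  have hK₂ : 0 ≤ (lam₂ * Real.exp (c.κ₁ * mJ₂) * Real.exp (5 * μ * r₂)) * (nB₂ * B6.c0 1 μ ^ ν) := by positivity
  have h := jointWalkExpansion_mul_torus e₁ e₂ (fun b => L₁.domBy_dist b) (fun b => L₂.domBy_dist b) hfib hμ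
    (by linarith) (by linarith) (by linarith) hK₁ hK₂
  have r1 : 2 * μ - μ = μ := by ring
  have r2 : 5 * μ - μ = 4 * μ := by ring
  rw [r1, r2] at h
  exact h

end NonVacuity

end Literature.MathematicalPhysics.QuantumFieldTheory.Balaban1983to89.B13JointWalkExpansionAlgebra

end
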